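import Mathlib
import Summits.NavierStokesRegularity.NavierStokesRegularity.Theorems.ThreadingFluxCentreJetLocalDriftLaw
import Summits.NavierStokesRegularity.NavierStokesRegularity.Theorems.ThreadingFluxCentreJetLowestTermFacts
import Summits.NavierStokesRegularity.NavierStokesRegularity.Theorems.ThreadingFluxCentreJetTriaxialFrameDegreeTwo
import HarnessLib

/-!
# Crux `PoloidalLiouville` (stmt-NavierStokesRegularity-1222, wall W1), crux idea «steady-centre-sieve» (ns-idea-15):
# POLHODE FORCING — at a zero-drift triaxial unthreaded steady centre the vorticity 2-jet is a multiple of `y × Sy`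

Support file (`--supports stmt-NavierStokesRegularity-1222`, helper; cell `ns-wall-extremal`, ns-wall-eng-7 g6, 0 kit).  The `k = 2`
companion of L1 `CentreJet.triaxialToroidalJetRigidity` (p696348): for a real-analytic steady Navier–Stokes flow on a ball, unthreaded
about `x₀`, with `V(x₀) = 0` and a triaxial strain `S = DV(x₀)` (orthonormal eigenbasis, distinct eigenvalues):

* `fderiv_curl_centre_eq_zero` — `D(curl V)(x₀) = 0` (so the hypothesis `ΔV(x₀) = 0` of L1 / C1″ is AUTOMATIC: the degree-1 cell is empty);
* `polhodeForcing` — `∃ μ, ∀ y, D²(curl V)(x₀)(y, y) = μ · y × S y`: the card's «`T₂ = λ⟪y,Sy⟫` is forced — vortex lines are polhodes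
  to leading order» (CentreJetSketch, docstring of C1″ `NoTriaxialPolhodeCentre`), i.e. the only possible non-zero vorticity 2-jet at
  such a centre is the Euler-top (polhode) field of the strain.

Proof: as for L1 — if `ω = curl V` is not locally zero its order of vanishing `k` satisfies the jet facts (layer (3)); `k ≠ 2` is
impossible by `TriaxialFrame.eq_zero_of_jetFacts`, so `k = 2`, the 1-jet vanishes, and the 2-jet is `μ · y × Sy` by
`TriaxialFrame.eq_smul_cross_of_jetFacts_two` (algebra: `HarmonicTangent.eq_smul_eulerTop_of_degree_two`).

HONEST FRAME: helper theorems about one crux idea's objects (untyped in the sketch at the time of writing); C1″ / C1 / C1* untouched;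
`PoloidalLiouville` (1222) and NS regularity OPEN; W1 movement 0.
-/

-- the summit and its single sub-problem share the name (CONVENTIONS §1)
set_option linter.dupNamespace false

noncomputable section

namespace Summit.NavierStokesRegularity.NavierStokesRegularity.Theorems.PoloidalLiouville.CentreJet

open Set Function Filter Topology Metric
open scoped ContDiff RealInnerProductSpace
open Literature.Analysis.FluidPDE

/-- **The vorticity jet at a zero-drift triaxial unthreaded steady centre.**  Either `curl V` vanishes near `x₀`, or its order of
vanishing at `x₀` is exactly `2` and its 2-jet is `μ · y × Sy`; in all cases `D(curl V)(x₀) = 0` and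
`∃ μ, D²(curl V)(x₀)(y,y) = μ · y × DV(x₀) y`. -/
theorem polhodeForcing_of (V : E3 → E3) (p : E3 → ℝ) (x₀ : E3) (ρ : ℝ) (hρ : 0 < ρ)
    (hV : AnalyticOnNhd ℝ V (ball x₀ ρ)) (hp : AnalyticOnNhd ℝ p (ball x₀ ρ)) (hNS : IsSteadyNSOn (ball x₀ ρ) V p)
    (hun : ∀ x ∈ ball x₀ ρ, ⟪x - x₀, curl V x⟫ = 0) (hV0 : V x₀ = 0)
    (hframe : ∃ (u : Fin 3 → E3) (e : Fin 3 → ℝ), Orthonormal ℝ u ∧ Function.Injective e ∧ ∀ i, fderiv ℝ V x₀ (u i) = e i • u i) :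
    fderiv ℝ (curl V) x₀ = 0 ∧
      ∃ μ : ℝ, ∀ y : E3, fderiv ℝ (fderiv ℝ (curl V)) x₀ y y = μ • cross y (fderiv ℝ V x₀ y) := by
  obtain ⟨u, e, hu, he, hSu⟩ := hframe
  have hx₀ : x₀ ∈ ball x₀ ρ := mem_ball_self hρ
  have hball : ball x₀ ρ ∈ 𝓝 x₀ := ball_mem_nhds x₀ hρ
  have hω : AnalyticOnNhd ℝ (curl V) (ball x₀ ρ) := by
    rw [curl_eq_curlCLM_comp]
    exact fun x hx => (curlCLM.analyticAt _).comp (hV.fderiv x hx)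
  -- case 1: `curl V` vanishes near `x₀`
  by_cases hzero : curl V =ᶠ[𝓝 x₀] 0
  · have h1 : fderiv ℝ (curl V) =ᶠ[𝓝 x₀] fderiv ℝ (fun _ : E3 => (0 : E3)) := hzero.fderiv
    have hD1 : fderiv ℝ (curl V) x₀ = 0 := by
      rw [h1.eq_of_nhds]; simp
    have hD2 : fderiv ℝ (fderiv ℝ (curl V)) x₀ = 0 := by
      rw [h1.fderiv_eq]; simp
    exact ⟨hD1, 0, fun y => by rw [hD2]; simp⟩
  -- case 2: order of vanishing `k`; localisation as in L1
  obtain ⟨k, hlow, ⟨y₀, hy₀⟩, -⟩ := AnalyticOrder.exists_order (hω x₀ hx₀) hzero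
  obtain ⟨hVc, hpc, hdiv, heq⟩ := hNS
  obtain ⟨W, hW, hWV⟩ := exists_contDiff_eventuallyEq_of_ball (n := 3) hρ (hV.contDiffOn_of_completeSpace.of_le le_top)
  obtain ⟨q, hq, hqp⟩ := exists_contDiff_eventuallyEq_of_ball (n := 2) hρ (hp.contDiffOn_of_completeSpace.of_le le_top)
  have hWV' := eventually_eventuallyEq_of_eventuallyEq hWV
  have hqp' := eventually_eventuallyEq_of_eventuallyEq hqp
  have hWω : ContDiffAt ℝ ω W x₀ := ((hV x₀ hx₀).contDiffAt).congr_of_eventuallyEq hWV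
  have hW0 : W x₀ = 0 := by rw [hWV.eq_of_nhds, hV0]
  have hfd : fderiv ℝ W x₀ = fderiv ℝ V x₀ := hWV.fderiv_eq
  have hcurl : curl W =ᶠ[𝓝 x₀] curl V := by
    filter_upwards [hWV'] with z hz
    rw [curl_eq_curlCLM, curl_eq_curlCLM, hz.fderiv_eq]
  have hNS' : ∀ᶠ x in 𝓝 x₀, fderiv ℝ W x (W x) + gradient q x = Laplacian.laplacian W x := by
    filter_upwards [hWV', hqp', hball] with z hz hzq hzb
    rw [hz.fderiv_eq, hz.eq_of_nhds, hzq.gradient_eq, (InnerProductSpace.laplacian_congr_nhds hz).eq_of_nhds]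
    exact heq z hzb
  have hdiv' : ∀ᶠ x in 𝓝 x₀, VectorCalculus.divergence W x = 0 := by
    filter_upwards [hWV', hball] with z hz hzb
    rw [VectorCalculus.divergence, hz.fderiv_eq]
    exact hdiv z hzb
  have htan' : ∀ᶠ x in 𝓝 x₀, ⟪x - x₀, curl W x⟫ = 0 := by
    filter_upwards [hWV', hball] with z hz hzb
    rw [curl_eq_curlCLM, hz.fderiv_eq, ← curl_eq_curlCLM]
    exact hun z hzb
  have hPk : ∀ n, iteratedFDeriv ℝ n (curl W) x₀ = iteratedFDeriv ℝ n (curl V) x₀ := fun n =>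
    (hcurl.iteratedFDeriv ℝ n).eq_of_nhds
  have hlowW : ∀ n < k, ∀ y : E3, iteratedFDeriv ℝ n (curl W) x₀ (fun _ => y) = 0 := fun n hn y => by
    rw [hPk n]; exact hlow n hn y
  set P : E3 → E3 := fun y => iteratedFDeriv ℝ k (curl W) x₀ (fun _ => y) with hP
  have hdivP : ∀ y, VectorCalculus.divergence P y = 0 :=
    LowestTerm.divergence_lowestTerm (hW.of_le (by norm_num)) hWω k
  have htanP : ∀ y, ⟪y, P y⟫ = 0 := LowestTerm.tangent_lowestTerm hWω htan' hlowW
  have hharmP : ∀ y, Laplacian.laplacian P y = 0 := LowestTerm.laplacian_lowestTerm hW hq hWω hNS' hdiv' hW0 hlowW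
  have hloopP : ∀ y, ⟪y, fderiv ℝ P y (fderiv ℝ V x₀ y) - fderiv ℝ V x₀ (P y)⟫ = 0 := fun y => by
    have h := LowestTerm.loopLaw_lowestTerm hW hq hWω hNS' hdiv' htan' hW0 hlowW y
    rwa [hfd] at h
  have htr : ∑ i, e i = 0 := by
    obtain ⟨ob, hob⟩ := TriaxialFrame.exists_orthonormalBasis_eq hu
    have h := hdiv x₀ hx₀
    rw [divergence_eq_sum_inner_fderiv ob] at h
    simp only [hob] at h
    rwa [TriaxialFrame.sum_inner_eigen hu (fderiv ℝ V x₀) hSu] at h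
  -- the order is exactly `2`
  have hk : k = 2 := by
    by_contra hk
    have hP0 : P = 0 :=
      TriaxialFrame.eq_zero_of_jetFacts P hk (JetCalculus.contDiff_diag k) (fun c y => JetCalculus.diag_smul k c y) hdivP htanP
        hharmP (fderiv ℝ V x₀) u e hu he hSu htr hloopP
    apply hy₀
    rw [← hPk k]
    exact congrFun hP0 y₀
  subst hk
  refine ⟨?_, ?_⟩
  · -- the 1-jet vanishes
    refine ContinuousLinearMap.ext fun y => ?_
    have h := hlow 1 (by norm_num) y
    simpa using h
  · -- the 2-jet is a polhode field
    obtain ⟨μ, hμ⟩ := TriaxialFrame.eq_smul_cross_of_jetFacts_two P (JetCalculus.contDiff_diag 2)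
      (fun c y => JetCalculus.diag_smul 2 c y) hdivP htanP hharmP (fderiv ℝ V x₀) u e hu he hSu htr hloopP
    refine ⟨μ, fun y => ?_⟩
    have h := hμ y
    simp only [hP, hPk 2] at h
    rw [← h, iteratedFDeriv_two_apply]

/-- **Corollary**: at such a centre `D(curl V)(x₀) = 0` — the «type N» alternative (`ΔV(x₀) ≠ 0`, i.e. `curl curl V(x₀) ≠ 0`) cannot
occur with zero drift and triaxial strain; in particular the hypothesis `ΔV(x₀) = 0` of L1 and C1″ is redundant there. -/
theorem fderiv_curl_centre_eq_zero (V : E3 → E3) (p : E3 → ℝ) (x₀ : E3) (ρ : ℝ) (hρ : 0 < ρ)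
    (hV : AnalyticOnNhd ℝ V (ball x₀ ρ)) (hp : AnalyticOnNhd ℝ p (ball x₀ ρ)) (hNS : IsSteadyNSOn (ball x₀ ρ) V p)
    (hun : ∀ x ∈ ball x₀ ρ, ⟪x - x₀, curl V x⟫ = 0) (hV0 : V x₀ = 0)
    (hframe : ∃ (u : Fin 3 → E3) (e : Fin 3 → ℝ), Orthonormal ℝ u ∧ Function.Injective e ∧ ∀ i, fderiv ℝ V x₀ (u i) = e i • u i) :
    fderiv ℝ (curl V) x₀ = 0 :=
  (polhodeForcing_of V p x₀ ρ hρ hV hp hNS hun hV0 hframe).1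

/-- ★ **`PolhodeForcing` holds** (the Defs-twin Prop, typed at the critic's request; binders = L1's minus `ΔV x₀ = 0` and the 2-jet
hypothesis). -/
theorem polhodeForcing : PolhodeForcing := fun V p x₀ ρ hρ hV hp hNS hun hV0 hframe =>
  polhodeForcing_of V p x₀ ρ hρ hV hp hNS hun hV0 hframe

/-- **Polarised form** (the mixed 2-jet, for consumers of `D²(curl V)(x₀)(y, z)`): with the same `μ`,
`D²(curl V)(x₀)(y, z) = (μ/2) · (y × Sz + z × Sy)`, `S = DV(x₀)` (symmetry of the second derivative + polarisation). -/
theorem polhodeForcing_bilinear (V : E3 → E3) (p : E3 → ℝ) (x₀ : E3) (ρ : ℝ) (hρ : 0 < ρ)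
    (hV : AnalyticOnNhd ℝ V (ball x₀ ρ)) (hp : AnalyticOnNhd ℝ p (ball x₀ ρ)) (hNS : IsSteadyNSOn (ball x₀ ρ) V p)
    (hun : ∀ x ∈ ball x₀ ρ, ⟪x - x₀, curl V x⟫ = 0) (hV0 : V x₀ = 0)
    (hframe : ∃ (u : Fin 3 → E3) (e : Fin 3 → ℝ), Orthonormal ℝ u ∧ Function.Injective e ∧ ∀ i, fderiv ℝ V x₀ (u i) = e i • u i) :
    ∃ μ : ℝ, ∀ y z : E3, fderiv ℝ (fderiv ℝ (curl V)) x₀ y z =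
      (μ / 2) • (cross y (fderiv ℝ V x₀ z) + cross z (fderiv ℝ V x₀ y)) := by
  obtain ⟨-, μ, hμ⟩ := polhodeForcing_of V p x₀ ρ hρ hV hp hNS hun hV0 hframe
  refine ⟨μ, fun y z => ?_⟩
  set B := fderiv ℝ (fderiv ℝ (curl V)) x₀ with hB
  set S := fderiv ℝ V x₀ with hS
  -- symmetry of the second derivative of the analytic field `curl V` at `x₀`
  have hω : AnalyticOnNhd ℝ (curl V) (ball x₀ ρ) := by
    rw [curl_eq_curlCLM_comp]
    exact fun x hx => (curlCLM.analyticAt _).comp (hV.fderiv x hx)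
  have hsymm : IsSymmSndFDerivAt ℝ (curl V) x₀ :=
    ((hω x₀ (mem_ball_self hρ)).contDiffAt (n := 2)).isSymmSndFDerivAt (by simp)
  -- polarisation: `B(y+z)(y+z) = B y y + 2 B y z + B z z`
  have e3 : B z y = B y z := hsymm z y
  have hL : B (y + z) (y + z) = B y y + B y z + B y z + B z z := by
    simp only [map_add, add_apply]
    rw [e3]
    abel
  have hR : cross (y + z) (S (y + z)) = cross y (S y) + cross y (S z) + cross z (S y) + cross z (S z) := by
    rw [map_add, ← crossCLM_apply, map_add, map_add, add_apply, add_apply]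
    simp only [crossCLM_apply]
    abel
  have key : B y z + B y z = μ • cross y (S z) + μ • cross z (S y) := by
    have h := hμ (y + z)
    rw [hL, hμ y, hμ z, hR, smul_add, smul_add, smul_add] at h
    calc B y z + B y z
        = (μ • cross y (S y) + B y z + B y z + μ • cross z (S z)) - μ • cross y (S y) - μ • cross z (S z) := by abel
      _ = (μ • cross y (S y) + μ • cross y (S z) + μ • cross z (S y) + μ • cross z (S z))
            - μ • cross y (S y) - μ • cross z (S z) := by rw [h]
      _ = μ • cross y (S z) + μ • cross z (S y) := by abel
  have h4 : B y z = (2 : ℝ)⁻¹ • (B y z + B y z) := by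
    rw [← two_smul ℝ (B y z), smul_smul]
    norm_num
  rw [h4, key, ← smul_add, smul_smul]
  congr 1
  ring

end Summit.NavierStokesRegularity.NavierStokesRegularity.Theorems.PoloidalLiouville.CentreJet

end
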